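import Summits.QuantumAdvantage.QuantumAdvantage.Theses.OddPrimeWalk
import Summits.QuantumAdvantage.AdviceFreeQNC0.WalkHardFAnchoredDirect

/-!
# Route OddPrimeWalk — aside `AnchoredOdd` (item stmt-QuantumAdvantage-22734, rung R2) closes from the tree

`AnchoredOdd := ∀ p prime, 5 ≤ p → WalkHardFAnchored p` is the landed theorem
`Summit.QuantumAdvantage.AdviceFreeQNC0.walkHardFAnchored (p) (hp3 : p ≠ 3)` (`WalkHardFAnchoredDirect.lean`,
p570505: anchored strategies — all shots in one polylog window, selections reading the whole input — lose on
`≥ η₀·2ⁿ` inputs, via the shift form, `chargeTriple`, the determined-by degree lemma and `elimHardF`),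
specialised to `p ≥ 5`.  Seat qa-qnc0-prover gen 10.
-/

set_option linter.dupNamespace false

namespace Summit.QuantumAdvantage.QuantumAdvantage.Theorems

/-- Item stmt-QuantumAdvantage-22734 `AnchoredOdd` of route OddPrimeWalk: for every prime `p ≥ 5`,
`WalkHardFAnchored p` — by `AdviceFreeQNC0.walkHardFAnchored` (`p ≠ 3` since `5 ≤ p`). -/
theorem anchoredOdd_proof : Summit.QuantumAdvantage.QuantumAdvantage.Theses.OddPrimeWalk.AnchoredOdd :=
  fun p _ hp => Summit.QuantumAdvantage.AdviceFreeQNC0.walkHardFAnchored p (by omega)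

end Summit.QuantumAdvantage.QuantumAdvantage.Theorems
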